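import Literature.MathematicalPhysics.QuantumFieldTheory.Balaban1983to89.B9Eq3126KFloorTowerDiagonal
import Literature.MathematicalPhysics.QuantumFieldTheory.Balaban1983to89.B9Eq3126KFloorWindowedKit
import Literature.MathematicalPhysics.QuantumFieldTheory.Balaban1983to89.B9Eq373DerivativeRemainderL2

/-!
# `Balaban1983to89.B9Eq3126KFloorWindowedTower` — T. Bałaban, *Propagators for lattice gauge theories in a background field*, Commun. Math. Phys. **99**
# (1985) 389–434 [Balaban1985BackgroundPropagators] (3.126) p. 420, Thm 3.11 p. 416, (3.26) p. 395, (3.35) p. 397 (the small-field windows), (3.70)–(3.79)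
# pp. 404–406, with [Balaban1985Variational] (45)–(46) p. 285: **THE WINDOWED BACKGROUND AT `k` LEVELS — the letters `(Q_k(U)G_k(U)Q_k(U)†)⁻¹` and
# `H_{1,k}(U)` of the pub-balaban NE9 chain are bounded from FORM letters of the background alone (`εR` transporters, `Kc` curvature form, `δQ`
# averaging in `L²`, a coercivity constant `γ`), by pulling the flat bond tent back along the tower isometry and perturbing its pairing and energy:
# `‖K⁻¹‖ ≤ M_U∕β_U²`, `‖H₁‖ ≤ √(M_U∕(γβ_U²))` — NO operator bound of `Δ^{(k)}_a(U)`, NO `C_R`; every new factor is an `α`-letter times the power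
# `L′^{4d+2}` of the squared margin, i.e. LEVEL-FREE BY TYPE on print's diagonal**

statement-level skeleton of published theorems with citation tags; proofs where landed; nothing here is a claim about the Yang–Mills mass gap

CITATION HEADER (lean-in-tree rule).  Audit cell `pub-balaban`, sub-cell `t4`, BINDER row NE9; filed by NE9 formalisation-swarm LEAF PROVER 02
(`b2b-balaban-t4-ne9-formalise-leaf-02`, gen 65).  Sources as the previous files of this lineage's programme: [Balaban1985BackgroundPropagators] pp. 391–397,
404–406, 416, 420; [Balaban1985Variational] p. 285; [Balaban1985Averaging] p. 36; tree inputs by name: the OWNER's `B9Eq316TowerFlatIsOneStep` (the port),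
`B9Eq373DerivativeRemainderL2` (`norm_covCurlL2K_sub_le`, `norm_covDivL2K_sub_le`), `B9Eq368ProjectionRemainder.norm_projR_le`.

THE PRINT (verbatim).  [B9] p. 397, (3.35): the small-field conditions on the bond variables and plaquettes; p. 406, (3.79): *«the operators Q(U), Q′(U) … are
analytic functions of U … ‖Q(U′U) − Q(U)‖ ≤ …»*; p. 416, Thm 3.11: *«the operators Δ′_a, G′, (Q′G′²Q′*)⁻¹, Δ_a, G are positive definite»*; p. 420, (3.126):
*«HB = GQ*(QGQ*)⁻¹B»*; [B11] p. 285 (46): *«|HB| ≤ B₀(L^jη)^{−1}|B|»* with `B₀` uniform.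

WHY THIS FILE (cell context).  `B9Eq3126KFloorTowerDiagonal` (this lineage) closes the FLAT k-level letters on the diagonal as `(d,a)`-numbers.  For a
background `U` inside print's windows the OWNER's Kato route (`B9Eq3126H1BoundTower` §3 via `B9Eq3126GreenLetters`) needs OPERATOR differences
`‖Δ_a(U) − Δ_a(1)‖ ∝ α∕η` (TOWER-R-PROGRAMME §1's diagnosis) — level-dependent.  In the variational currency only FORMS of the FIXED test family enter:
`re⟪Q_k(U)u, ψ⟫ ≥ re⟪Q_k(1)u, ψ⟫ − ‖(Q_k(U)−Q_k(1))u‖‖ψ‖` and `re⟪u, Δ^{(k)}_a(U)u⟫ ≤ ‖curl_U u‖² + ‖⟪u, Δ′(U)u⟫‖ + ‖D*_U u‖² + a‖Q_k(U)u‖²` (§1: `R_k(U)` is a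
contraction — NO Lipschitz letter of `R`), with `‖curl_U u − curl_1 u‖ ≤ 4√d‖η⁻¹‖εR‖u‖`, `‖D*_U u − D*_1 u‖ ≤ ‖η⁻¹‖εR√d‖u‖` (`εR ∝ αη` from the bond
window, so `‖η⁻¹‖εR ∝ α`), `‖⟪u, Δ′(U)u⟫‖ ≤ Kc‖u‖²` (`Kc ∝ α` from the plaquette window), `‖(Q_k(U) − Q_k(1))u‖ ≤ δQ‖u‖` (`δQ ∝ α`, this lineage's `L²`
letters `B9Eq315QTowerLipschitzL2`), and the size `‖u‖² ≤ N²‖ψ‖²` of the tent (§2).  So the `k`-level `C_H`, `C_K` at a windowed background are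
`(d, a, α-letters)`-numbers on the diagonal — the `H`-side twin of the TOWER-R conclusion, with no `C_R` at all.

WHAT IS PROVED (sorry-free; 0 `def`; [folklore]; nothing of [B9]∕[B11] asserted; the windows enter only through the displayed letters).
* (the three small letters — energy as forms §1, tent size §2, pairing perturbation §3 — are the companion `B9Eq3126KFloorWindowedKit`, BY NAME)
* **`norm_KinvLatticeK_H1LatticeK_tower_windowed_le`** — at `k = n+1` levels, for a background `U` with tower data, the flat tower data, the one-step
  letters at block `L^{n+1}` and the period identity as binders; displayed `hRS`, the symmetry of `Δ^{(k)}_a(U)` (`B9Eq326OperatorTower.laplaceAk_isSymmetric`),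
  `εR`, `Kc`, `δQ`, `β_U := (A−B) − δQ·N > 0`, a coercivity constant `γ`, ANY `hpos`, `hQ`:
  `‖KinvLatticeK hpos hQ y‖ ≤ (M_U∕β_U²)‖y‖` and `‖H1LatticeK hpos hQ b‖ ≤ √(M_U∕(γβ_U²))‖b‖`,
  `M_U = 2M_u + (2(4√d‖η⁻¹‖εR)² + 2(‖η⁻¹‖εR√d)² + Kc + 2aδQ²)N²` (`M_u`, `A`, `B`, `N` the flat tent's numbers at block `L^{n+1}`).
HONEST SCOPE.  Crude constants; the `α`-dependence of `εR`, `Kc`, `δQ` is the consumers' (they are the chain's standard letters); `β_U > 0` is a smallness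
condition on `δQ` (∝ `α ≤ α₀(d)` on the diagonal) DISPLAYED, not derived; `γ` displayed (INTENT-8∕-9 of the OWNER on the diagonal); NOT (46)'s kernel bound ∕
Thm 3.12; NOT NE9, NOT the route (cell pub-balaban: NE9 NOT PRINTED ∕ NOT PROVED; «NE9 ⇐ the named binders»; row WALLED ON A MODEL (O-NE9-1; #5 UNRULED); spine
PROVED 0∕9; rung (B)+1 on a finite T⁴ — NOT infinite volume, NOT mass gap, NOT BetaPertH, NOT Clay).  HONEST DEPENDENCY (cell line): continuum YM on T⁴ ⇐ BetaPertH ∧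
nine spine estimates (0/9 proved); BetaPertH ⇐ (D1) ∧ (D4) ∧ CAP+tail; G-an2-4 gates asym, D1 and NE2/3/4.  NEW file importing `B9Eq3126KFloorTowerDiagonal`,
`B9Eq3126KFloorWindowedKit` (this lineage) and `B9Eq373DerivativeRemainderL2`; nothing modified.  Net new unproved facts: 0.
-/

noncomputable section

open scoped InnerProductSpace ComplexConjugate BigOperators

namespace Literature.MathematicalPhysics.QuantumFieldTheory.Balaban1983to89.B9Eq3126KFloorWindowedTower

open B9SectCLatticeCarrier (Bond shift)
open B9Eq311L2Pairing (WL2)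
open B11Eq103H1Complex (SiteL2K BondL2K covDerivL2K covDivL2K laplaceALatticeK laplaceAK laplaceAK_apply adjoint_covDerivL2K)
open B9Eq310HessianOperator (adTransportW hessOp hessOp_apply principalOpK_eq_comp covCurlL2K curvOp inner_covCoCurlL2K_covCurlL2K)
open B9Eq3126KFloorWindowedKit (re_inner_laplaceALatticeK_hessOp_le norm_sq_tent_le pairing_perturb norm_sq_le_two_mul)

/-! ## The windowed background at `k` levels: the bond tent's pairing and energy letters for `Δ^{(k)}_a(U)`, `Q_k(U)` -/

section Windowed

open B4Sect5Torus (TSite)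
open B9Eq319QprimeTorus (fineP offset blockCoord)
open B9Eq315QTorus (perCfg cornerSite QtorusW laplaceAofBackground laplaceAofBackground_eq)
open B9Eq315QTower (towerP UlevOf)
open B7Prop1Explicit (U1 Wcx boxVec)
open B11Eq103H1Complex (H1LatticeK KinvLatticeK hadj_adjoint adjoint_injective_of_surjective)
open B9Eq310HessianOperator (hessOp_one)
open B5Eq172HodgePositivity (hRS_one adTransportW_one adTransportW_inv_one)
open B9Eq326OperatorAssembly (laplaceAofU_eq)
open B9Eq326OperatorTower (QkW RofUk laplaceAk)
open B9Eq316TowerFlatIsOneStep (bondL2Cast norm_bondL2Cast inner_bondL2Cast QkW_one_eq_oneStep principalLaplacek_one_eq_oneStep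
  norm_covCurlL2K_one_bondL2Cast norm_covDivL2K_inv_one_bondL2Cast)
open B9Eq373DerivativeRemainderL2 (norm_covCurlL2K_sub_le norm_covDivL2K_sub_le)
open B9Eq368ProjectionRemainder (norm_projR_le)

variable {d : ℕ} {𝔸 : Type*} [NormedRing 𝔸] [NormedAlgebra ℂ 𝔸] [CompleteSpace 𝔸] [NormOneClass 𝔸] [StarRing 𝔸] [StarModule ℂ 𝔸]
  (L : ℕ) [NeZero L] (m : Fin d → ℕ) [∀ i, NeZero (m i)] (n : ℕ) (hL : 1 ≤ L)
  {W : Type*} [NormedAddCommGroup W] [InnerProductSpace ℂ W] [FiniteDimensional ℂ W] (φ : W ≃ₗ[ℂ] 𝔸) {c₀ c₁ : ℝ} [Fact (0 < c₀)] [Fact (0 < c₁)]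
  (η : ℝ) (τ : 𝔸 →ₗ[ℂ] ℂ) (U : Bond d (towerP L m (n + 1)) → 𝔸ˣ)
  (α : ℕ → ℝ) (hα1 : ∀ j, α j ≤ 1 / 64)
  (hU1 : ∀ (j : ℕ) (x : B7Prop1Explicit.Site d) (κ : Fin d), perCfg (towerP L m (j + 1)) (UlevOf L m (n + 1) U j) x κ ∈ U1 𝔸)
  (hreg : ∀ (j : ℕ) (y : TSite d (towerP L m j)) (κ : Fin d) (r : Fin d → Fin L),
    ‖((Wcx L (perCfg (towerP L m (j + 1)) (UlevOf L m (n + 1) U j)) (cornerSite L y) κ (boxVec L r) : 𝔸ˣ) : 𝔸) - 1‖ ≤ α j)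
  (α₁ : ℕ → ℝ) (hα1₁ : ∀ j, α₁ j ≤ 1 / 64)
  (hU1₁ : ∀ (j : ℕ) (x : B7Prop1Explicit.Site d) (κ : Fin d),
    perCfg (towerP L m (j + 1)) (UlevOf L m (n + 1) (fun _ : Bond d (towerP L m (n + 1)) => (1 : 𝔸ˣ)) j) x κ ∈ U1 𝔸)
  (hreg₁ : ∀ (j : ℕ) (y : TSite d (towerP L m j)) (κ : Fin d) (r : Fin d → Fin L),
    ‖((Wcx L (perCfg (towerP L m (j + 1)) (UlevOf L m (n + 1) (fun _ : Bond d (towerP L m (n + 1)) => (1 : 𝔸ˣ)) j)) (cornerSite L y) κ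
      (boxVec L r) : 𝔸ˣ) : 𝔸) - 1‖ ≤ α₁ j)
  (hLk : 1 ≤ L ^ (n + 1)) {α' : ℝ} (hα1' : α' ≤ 1 / 64)
  (hU1' : ∀ (x : B7Prop1Explicit.Site d) (κ : Fin d),
    perCfg (fineP (L ^ (n + 1)) m) (fun _ : Bond d (fineP (L ^ (n + 1)) m) => (1 : 𝔸ˣ)) x κ ∈ U1 𝔸)
  (hreg' : ∀ (y : TSite d m) (κ : Fin d) (r : Fin d → Fin (L ^ (n + 1))),
    ‖((Wcx (L ^ (n + 1)) (perCfg (fineP (L ^ (n + 1)) m) (fun _ : Bond d (fineP (L ^ (n + 1)) m) => (1 : 𝔸ˣ))) (cornerSite (L ^ (n + 1)) y) κ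
      (boxVec (L ^ (n + 1)) r) : 𝔸ˣ) : 𝔸) - 1‖ ≤ α')
  (h : towerP L m (n + 1) = fineP (L ^ (n + 1)) m)

include hLk hα1' hU1' hreg' h hL hα1₁ hU1₁ hreg₁ in
/-- **THE WINDOWED BACKGROUND AT `k` LEVELS — THE VARIATIONAL LETTERS BY FORM PERTURBATION.**  Displayed: the mutual adjointness `hRS` of the
transporters of `U`; a transporter letter `εR` (`‖R(U(b))w − w‖ ≤ εR‖w‖` — from the BOND window `‖U(b) − 1‖ ≤ αη` it is `∝ αη`); a curvature FORM letter
`Kc` (`‖⟪x, Δ′(U)x⟫‖ ≤ Kc‖x‖²` — from the PLAQUETTE window, `∝ α` on the diagonal, `B9Ineq369CurvatureSmall`); the averaging letter `δQ`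
(`‖Q_k(U)f − Q_k(1)f‖ ≤ δQ‖f‖`, level-free in `L²`: `B9Eq315QTowerLipschitzL2`); a coercivity constant `γ` of `Δ^{(k)}_a(U)`; ANY `hpos`, `hQ`.  Then with the
bond tent of block `L^{n+1}` pulled back along `Φ` (pairing margin `A − B`, energy `M_u`, size `N² = (L′³(L′²∕4)^{d−1})²(c₀L′^d∕c₁)`, `L′ = L^{n+1}`) and
`β_U := (A − B) − δQ·N > 0`:
`‖(Q_k(U)G_k(U)Q_k(U)†)⁻¹y‖ ≤ (M_U∕β_U²)‖y‖`, `‖H_{1,k}(U)b‖ ≤ √(M_U∕(γβ_U²))‖b‖`,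
`M_U = 2M_u + (2·(4√d·‖η⁻¹‖εR)² + 2·(‖η⁻¹‖εR√d)² + Kc + 2a·δQ²)·N²` — every new factor is `‖η⁻¹‖εR ∝ α`, `Kc ∝ α`, `δQ ∝ α` times `N² ∝ L′^{4d+2}`, the power of
`(A−B)²`: LEVEL-FREE on the diagonal given the windows.  NO operator bound of `Δ^{(k)}_a(U)`, no `C_R`. [folklore]
[cite: Balaban1985BackgroundPropagators, (3.126) p.420, Thm 3.11 p.416, (3.79) p.406, (3.70)–(3.73) pp.404–405, (3.35) p.397; Balaban1985Variational, (45)–(46) p.285] -/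
theorem norm_KinvLatticeK_H1LatticeK_tower_windowed_le (hL3 : 3 ≤ L ^ (n + 1)) {a : ℝ} (ha : 0 < a)
    (hRS : ∀ (b : Bond d (towerP L m (n + 1))) (v u : W), ⟪adTransportW φ U b v, u⟫_ℂ = ⟪v, adTransportW φ (fun b => (U b)⁻¹) b u⟫_ℂ)
    (hsym : (laplaceAk L m n φ η U hL α hα1 hU1 hreg τ (c₀ := c₀) (c₁ := c₁) a).IsSymmetric)
    {εR : ℝ} (hεR : 0 ≤ εR) (hR : ∀ (b : Bond d (towerP L m (n + 1))) (w : W), ‖adTransportW φ U b w - w‖ ≤ εR * ‖w‖)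
    {Kc : ℝ} (hKc : 0 ≤ Kc) (hcurv : ∀ x : BondL2K ℂ d (towerP L m (n + 1)) c₀ W, ‖⟪x, curvOp φ τ η U x⟫_ℂ‖ ≤ Kc * ‖x‖ ^ 2)
    {δQ : ℝ} (hδQ : 0 ≤ δQ)
    (hQd : ∀ f : BondL2K ℂ d (towerP L m (n + 1)) c₀ W,
      ‖QkW L m n φ U hL α hα1 hU1 hreg (c₀ := c₀) (c₁ := c₁) f -
        QkW L m n φ (fun _ : Bond d (towerP L m (n + 1)) => (1 : 𝔸ˣ)) hL α₁ hα1₁ hU1₁ hreg₁ (c₀ := c₀) (c₁ := c₁) f‖ ≤ δQ * ‖f‖)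
    (hβU : 0 < (((((L ^ (n + 1) : ℕ) : ℝ) ^ (d + 1))⁻¹ * ((∑ k ∈ Finset.range (L ^ (n + 1)), (k : ℝ) * ((((L ^ (n + 1) : ℕ) : ℝ)) - 1 - k)) ^ (d - 1) *
          ∑ k ∈ Finset.range (L ^ (n + 1)), ∑ i ∈ Finset.range (L ^ (n + 1) - k), ((k + i : ℕ) : ℝ) ^ 2 * ((((L ^ (n + 1) : ℕ) : ℝ)) - 1 - ((k + i : ℕ) : ℝ)))) -
        ((((L ^ (n + 1) : ℕ) : ℝ) ^ (d + 1))⁻¹ * ((∑ k ∈ Finset.range (L ^ (n + 1)), (k : ℝ) * ((((L ^ (n + 1) : ℕ) : ℝ)) - 1 - k)) ^ (d - 1) *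
          ∑ k ∈ Finset.range (L ^ (n + 1)), ∑ t ∈ Finset.range k, (t : ℝ) ^ 2 * ((((L ^ (n + 1) : ℕ) : ℝ)) - 1 - t)))) - δQ * Real.sqrt (((((L ^ (n + 1) : ℕ) : ℝ)) ^ 3 * ((((L ^ (n + 1) : ℕ) : ℝ)) ^ 2 / 4) ^ (d - 1)) ^ 2 * (c₀ * (((L ^ (n + 1) : ℕ) : ℝ)) ^ d / c₁)))
    {γ : ℝ} (hγ : 0 < γ)
    (hcoer : ∀ x : BondL2K ℂ d (towerP L m (n + 1)) c₀ W, γ * ‖x‖ ^ 2 ≤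
      RCLike.re ⟪x, laplaceAk L m n φ η U hL α hα1 hU1 hreg τ (c₀ := c₀) (c₁ := c₁) a x⟫_ℂ)
    (hpos : ∀ x : BondL2K ℂ d (towerP L m (n + 1)) c₀ W, x ≠ 0 →
      0 < RCLike.re ⟪x, laplaceAk L m n φ η U hL α hα1 hU1 hreg τ (c₀ := c₀) (c₁ := c₁) a x⟫_ℂ)
    (hQ : Function.Surjective (QkW L m n φ U hL α hα1 hU1 hreg (c₀ := c₀) (c₁ := c₁))) :
    (∀ y : BondL2K ℂ d m c₁ W, ‖KinvLatticeK hpos hQ y‖ ≤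
        (2 * (‖((η : ℂ))⁻¹‖ ^ 2 * (6 * (((L ^ (n + 1) : ℕ) : ℝ)) ^ 2 * ((((L ^ (n + 1) : ℕ) : ℝ)) ^ 2 / 4) ^ (d - 1)) ^ 2 * (5 * (d : ℝ)) *
      (c₀ * (((L ^ (n + 1) : ℕ) : ℝ)) ^ d / c₁) +
        a * (2 * (((((L ^ (n + 1) : ℕ) : ℝ) ^ (d + 1))⁻¹ * ((∑ k ∈ Finset.range (L ^ (n + 1)), (k : ℝ) * ((((L ^ (n + 1) : ℕ) : ℝ)) - 1 - k)) ^ (d - 1) *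
          ∑ k ∈ Finset.range (L ^ (n + 1)), ∑ i ∈ Finset.range (L ^ (n + 1) - k), ((k + i : ℕ) : ℝ) ^ 2 * ((((L ^ (n + 1) : ℕ) : ℝ)) - 1 - ((k + i : ℕ) : ℝ)))) ^ 2 +
          ((((L ^ (n + 1) : ℕ) : ℝ) ^ (d + 1))⁻¹ * ((∑ k ∈ Finset.range (L ^ (n + 1)), (k : ℝ) * ((((L ^ (n + 1) : ℕ) : ℝ)) - 1 - k)) ^ (d - 1) *
          ∑ k ∈ Finset.range (L ^ (n + 1)), ∑ t ∈ Finset.range k, (t : ℝ) ^ 2 * ((((L ^ (n + 1) : ℕ) : ℝ)) - 1 - t))) ^ 2))) +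
          (2 * (4 * Real.sqrt d * (‖((η : ℂ))⁻¹‖ * εR)) ^ 2 + 2 * (‖((η : ℂ))⁻¹‖ * εR * Real.sqrt d) ^ 2 + Kc + 2 * a * δQ ^ 2) *
            (((((L ^ (n + 1) : ℕ) : ℝ)) ^ 3 * ((((L ^ (n + 1) : ℕ) : ℝ)) ^ 2 / 4) ^ (d - 1)) ^ 2 * (c₀ * (((L ^ (n + 1) : ℕ) : ℝ)) ^ d / c₁))) /
          ((((((L ^ (n + 1) : ℕ) : ℝ) ^ (d + 1))⁻¹ * ((∑ k ∈ Finset.range (L ^ (n + 1)), (k : ℝ) * ((((L ^ (n + 1) : ℕ) : ℝ)) - 1 - k)) ^ (d - 1) *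
          ∑ k ∈ Finset.range (L ^ (n + 1)), ∑ i ∈ Finset.range (L ^ (n + 1) - k), ((k + i : ℕ) : ℝ) ^ 2 * ((((L ^ (n + 1) : ℕ) : ℝ)) - 1 - ((k + i : ℕ) : ℝ)))) -
            ((((L ^ (n + 1) : ℕ) : ℝ) ^ (d + 1))⁻¹ * ((∑ k ∈ Finset.range (L ^ (n + 1)), (k : ℝ) * ((((L ^ (n + 1) : ℕ) : ℝ)) - 1 - k)) ^ (d - 1) *
          ∑ k ∈ Finset.range (L ^ (n + 1)), ∑ t ∈ Finset.range k, (t : ℝ) ^ 2 * ((((L ^ (n + 1) : ℕ) : ℝ)) - 1 - t)))) - δQ * Real.sqrt (((((L ^ (n + 1) : ℕ) : ℝ)) ^ 3 * ((((L ^ (n + 1) : ℕ) : ℝ)) ^ 2 / 4) ^ (d - 1)) ^ 2 * (c₀ * (((L ^ (n + 1) : ℕ) : ℝ)) ^ d / c₁))) ^ 2 * ‖y‖) ∧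
      ∀ b : BondL2K ℂ d m c₁ W, ‖H1LatticeK hpos hQ b‖ ≤
        Real.sqrt ((2 * (‖((η : ℂ))⁻¹‖ ^ 2 * (6 * (((L ^ (n + 1) : ℕ) : ℝ)) ^ 2 * ((((L ^ (n + 1) : ℕ) : ℝ)) ^ 2 / 4) ^ (d - 1)) ^ 2 * (5 * (d : ℝ)) *
      (c₀ * (((L ^ (n + 1) : ℕ) : ℝ)) ^ d / c₁) +
        a * (2 * (((((L ^ (n + 1) : ℕ) : ℝ) ^ (d + 1))⁻¹ * ((∑ k ∈ Finset.range (L ^ (n + 1)), (k : ℝ) * ((((L ^ (n + 1) : ℕ) : ℝ)) - 1 - k)) ^ (d - 1) *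
          ∑ k ∈ Finset.range (L ^ (n + 1)), ∑ i ∈ Finset.range (L ^ (n + 1) - k), ((k + i : ℕ) : ℝ) ^ 2 * ((((L ^ (n + 1) : ℕ) : ℝ)) - 1 - ((k + i : ℕ) : ℝ)))) ^ 2 +
          ((((L ^ (n + 1) : ℕ) : ℝ) ^ (d + 1))⁻¹ * ((∑ k ∈ Finset.range (L ^ (n + 1)), (k : ℝ) * ((((L ^ (n + 1) : ℕ) : ℝ)) - 1 - k)) ^ (d - 1) *
          ∑ k ∈ Finset.range (L ^ (n + 1)), ∑ t ∈ Finset.range k, (t : ℝ) ^ 2 * ((((L ^ (n + 1) : ℕ) : ℝ)) - 1 - t))) ^ 2))) +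
          (2 * (4 * Real.sqrt d * (‖((η : ℂ))⁻¹‖ * εR)) ^ 2 + 2 * (‖((η : ℂ))⁻¹‖ * εR * Real.sqrt d) ^ 2 + Kc + 2 * a * δQ ^ 2) *
            (((((L ^ (n + 1) : ℕ) : ℝ)) ^ 3 * ((((L ^ (n + 1) : ℕ) : ℝ)) ^ 2 / 4) ^ (d - 1)) ^ 2 * (c₀ * (((L ^ (n + 1) : ℕ) : ℝ)) ^ d / c₁))) /
          (γ * ((((((L ^ (n + 1) : ℕ) : ℝ) ^ (d + 1))⁻¹ * ((∑ k ∈ Finset.range (L ^ (n + 1)), (k : ℝ) * ((((L ^ (n + 1) : ℕ) : ℝ)) - 1 - k)) ^ (d - 1) *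
          ∑ k ∈ Finset.range (L ^ (n + 1)), ∑ i ∈ Finset.range (L ^ (n + 1) - k), ((k + i : ℕ) : ℝ) ^ 2 * ((((L ^ (n + 1) : ℕ) : ℝ)) - 1 - ((k + i : ℕ) : ℝ)))) -
            ((((L ^ (n + 1) : ℕ) : ℝ) ^ (d + 1))⁻¹ * ((∑ k ∈ Finset.range (L ^ (n + 1)), (k : ℝ) * ((((L ^ (n + 1) : ℕ) : ℝ)) - 1 - k)) ^ (d - 1) *
          ∑ k ∈ Finset.range (L ^ (n + 1)), ∑ t ∈ Finset.range k, (t : ℝ) ^ 2 * ((((L ^ (n + 1) : ℕ) : ℝ)) - 1 - t)))) - δQ * Real.sqrt (((((L ^ (n + 1) : ℕ) : ℝ)) ^ 3 * ((((L ^ (n + 1) : ℕ) : ℝ)) ^ 2 / 4) ^ (d - 1)) ^ 2 * (c₀ * (((L ^ (n + 1) : ℕ) : ℝ)) ^ d / c₁))) ^ 2)) * ‖b‖ := by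
  have hc₀ : 0 < c₀ := Fact.out
  have hc₁ : 0 < c₁ := Fact.out
  have hc : conj (((η : ℂ))⁻¹) = ((η : ℂ))⁻¹ := by rw [map_inv₀, Complex.conj_ofReal]
  have hL0 : (0 : ℝ) < ((L ^ (n + 1) : ℕ) : ℝ) := by exact_mod_cast (by omega : 0 < L ^ (n + 1))
  -- the flat test family (pulled back along `Φ`) and its one-step letters at block `L^{n+1}`
  have hc1 : ‖((η : ℂ))⁻¹‖ ^ 2 * (6 * (((L ^ (n + 1) : ℕ) : ℝ)) ^ 2 * ((((L ^ (n + 1) : ℕ) : ℝ)) ^ 2 / 4) ^ (d - 1)) ^ 2 * (5 * (d : ℝ)) * (c₀ * (((L ^ (n + 1) : ℕ) : ℝ)) ^ d / c₁) ≥ 0 := by positivity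
  have hNsq : 0 ≤ (((((L ^ (n + 1) : ℕ) : ℝ)) ^ 3 * ((((L ^ (n + 1) : ℕ) : ℝ)) ^ 2 / 4) ^ (d - 1)) ^ 2 * (c₀ * (((L ^ (n + 1) : ℕ) : ℝ)) ^ d / c₁)) := by positivity
  -- per test vector: the pieces
  have key : ∀ ψ : BondL2K ℂ d m c₁ W,
      ‖((bondL2Cast ℂ h).symm
          ((WL2.equiv ℂ (fun _ : Bond d (fineP (L ^ (n + 1)) m) => c₀) W).symm
          (fun b => (((((offset (L ^ (n + 1)) m b.1 b.2 : ℕ) : ℝ) ^ 2 * (((L ^ (n + 1) : ℕ) : ℝ) - 1 - (offset (L ^ (n + 1)) m b.1 b.2 : ℕ))) *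
              ∏ ν ∈ Finset.univ.erase b.2, (((offset (L ^ (n + 1)) m b.1 ν : ℕ) : ℝ) * (((L ^ (n + 1) : ℕ) : ℝ) - 1 - (offset (L ^ (n + 1)) m b.1 ν : ℕ))) : ℝ) : ℂ) •
            WL2.equiv ℂ (fun _ : Bond d m => c₁) W ψ (blockCoord (L ^ (n + 1)) m b.1, b.2))))‖ ≤ Real.sqrt (((((L ^ (n + 1) : ℕ) : ℝ)) ^ 3 * ((((L ^ (n + 1) : ℕ) : ℝ)) ^ 2 / 4) ^ (d - 1)) ^ 2 * (c₀ * (((L ^ (n + 1) : ℕ) : ℝ)) ^ d / c₁)) * ‖ψ‖ ∧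
      ((((((L ^ (n + 1) : ℕ) : ℝ) ^ (d + 1))⁻¹ * ((∑ k ∈ Finset.range (L ^ (n + 1)), (k : ℝ) * ((((L ^ (n + 1) : ℕ) : ℝ)) - 1 - k)) ^ (d - 1) *
          ∑ k ∈ Finset.range (L ^ (n + 1)), ∑ i ∈ Finset.range (L ^ (n + 1) - k), ((k + i : ℕ) : ℝ) ^ 2 * ((((L ^ (n + 1) : ℕ) : ℝ)) - 1 - ((k + i : ℕ) : ℝ)))) -
          ((((L ^ (n + 1) : ℕ) : ℝ) ^ (d + 1))⁻¹ * ((∑ k ∈ Finset.range (L ^ (n + 1)), (k : ℝ) * ((((L ^ (n + 1) : ℕ) : ℝ)) - 1 - k)) ^ (d - 1) *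
          ∑ k ∈ Finset.range (L ^ (n + 1)), ∑ t ∈ Finset.range k, (t : ℝ) ^ 2 * ((((L ^ (n + 1) : ℕ) : ℝ)) - 1 - t)))) - δQ * Real.sqrt (((((L ^ (n + 1) : ℕ) : ℝ)) ^ 3 * ((((L ^ (n + 1) : ℕ) : ℝ)) ^ 2 / 4) ^ (d - 1)) ^ 2 * (c₀ * (((L ^ (n + 1) : ℕ) : ℝ)) ^ d / c₁))) * ‖ψ‖ ^ 2 ≤
        RCLike.re ⟪QkW L m n φ U hL α hα1 hU1 hreg (c₀ := c₀) (c₁ := c₁)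
          ((bondL2Cast ℂ h).symm
          ((WL2.equiv ℂ (fun _ : Bond d (fineP (L ^ (n + 1)) m) => c₀) W).symm
          (fun b => (((((offset (L ^ (n + 1)) m b.1 b.2 : ℕ) : ℝ) ^ 2 * (((L ^ (n + 1) : ℕ) : ℝ) - 1 - (offset (L ^ (n + 1)) m b.1 b.2 : ℕ))) *
              ∏ ν ∈ Finset.univ.erase b.2, (((offset (L ^ (n + 1)) m b.1 ν : ℕ) : ℝ) * (((L ^ (n + 1) : ℕ) : ℝ) - 1 - (offset (L ^ (n + 1)) m b.1 ν : ℕ))) : ℝ) : ℂ) •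
            WL2.equiv ℂ (fun _ : Bond d m => c₁) W ψ (blockCoord (L ^ (n + 1)) m b.1, b.2)))), ψ⟫_ℂ ∧
      RCLike.re ⟪((bondL2Cast ℂ h).symm
          ((WL2.equiv ℂ (fun _ : Bond d (fineP (L ^ (n + 1)) m) => c₀) W).symm
          (fun b => (((((offset (L ^ (n + 1)) m b.1 b.2 : ℕ) : ℝ) ^ 2 * (((L ^ (n + 1) : ℕ) : ℝ) - 1 - (offset (L ^ (n + 1)) m b.1 b.2 : ℕ))) *
              ∏ ν ∈ Finset.univ.erase b.2, (((offset (L ^ (n + 1)) m b.1 ν : ℕ) : ℝ) * (((L ^ (n + 1) : ℕ) : ℝ) - 1 - (offset (L ^ (n + 1)) m b.1 ν : ℕ))) : ℝ) : ℂ) •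
            WL2.equiv ℂ (fun _ : Bond d m => c₁) W ψ (blockCoord (L ^ (n + 1)) m b.1, b.2)))),
        laplaceAk L m n φ η U hL α hα1 hU1 hreg τ (c₀ := c₀) (c₁ := c₁) a
          ((bondL2Cast ℂ h).symm
          ((WL2.equiv ℂ (fun _ : Bond d (fineP (L ^ (n + 1)) m) => c₀) W).symm
          (fun b => (((((offset (L ^ (n + 1)) m b.1 b.2 : ℕ) : ℝ) ^ 2 * (((L ^ (n + 1) : ℕ) : ℝ) - 1 - (offset (L ^ (n + 1)) m b.1 b.2 : ℕ))) *
              ∏ ν ∈ Finset.univ.erase b.2, (((offset (L ^ (n + 1)) m b.1 ν : ℕ) : ℝ) * (((L ^ (n + 1) : ℕ) : ℝ) - 1 - (offset (L ^ (n + 1)) m b.1 ν : ℕ))) : ℝ) : ℂ) •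
            WL2.equiv ℂ (fun _ : Bond d m => c₁) W ψ (blockCoord (L ^ (n + 1)) m b.1, b.2))))⟫_ℂ ≤
        (2 * (‖((η : ℂ))⁻¹‖ ^ 2 * (6 * (((L ^ (n + 1) : ℕ) : ℝ)) ^ 2 * ((((L ^ (n + 1) : ℕ) : ℝ)) ^ 2 / 4) ^ (d - 1)) ^ 2 * (5 * (d : ℝ)) * (c₀ * (((L ^ (n + 1) : ℕ) : ℝ)) ^ d / c₁) +
            a * (2 * (((((L ^ (n + 1) : ℕ) : ℝ) ^ (d + 1))⁻¹ * ((∑ k ∈ Finset.range (L ^ (n + 1)), (k : ℝ) * ((((L ^ (n + 1) : ℕ) : ℝ)) - 1 - k)) ^ (d - 1) *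
          ∑ k ∈ Finset.range (L ^ (n + 1)), ∑ i ∈ Finset.range (L ^ (n + 1) - k), ((k + i : ℕ) : ℝ) ^ 2 * ((((L ^ (n + 1) : ℕ) : ℝ)) - 1 - ((k + i : ℕ) : ℝ)))) ^ 2 +
              ((((L ^ (n + 1) : ℕ) : ℝ) ^ (d + 1))⁻¹ * ((∑ k ∈ Finset.range (L ^ (n + 1)), (k : ℝ) * ((((L ^ (n + 1) : ℕ) : ℝ)) - 1 - k)) ^ (d - 1) *
          ∑ k ∈ Finset.range (L ^ (n + 1)), ∑ t ∈ Finset.range k, (t : ℝ) ^ 2 * ((((L ^ (n + 1) : ℕ) : ℝ)) - 1 - t))) ^ 2))) +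
          (2 * (4 * Real.sqrt d * (‖((η : ℂ))⁻¹‖ * εR)) ^ 2 + 2 * (‖((η : ℂ))⁻¹‖ * εR * Real.sqrt d) ^ 2 + Kc + 2 * a * δQ ^ 2) * (((((L ^ (n + 1) : ℕ) : ℝ)) ^ 3 * ((((L ^ (n + 1) : ℕ) : ℝ)) ^ 2 / 4) ^ (d - 1)) ^ 2 * (c₀ * (((L ^ (n + 1) : ℕ) : ℝ)) ^ d / c₁))) * ‖ψ‖ ^ 2 := by
    intro ψ
    set u' : BondL2K ℂ d (fineP (L ^ (n + 1)) m) c₀ W := ((WL2.equiv ℂ (fun _ : Bond d (fineP (L ^ (n + 1)) m) => c₀) W).symm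
          (fun b => (((((offset (L ^ (n + 1)) m b.1 b.2 : ℕ) : ℝ) ^ 2 * (((L ^ (n + 1) : ℕ) : ℝ) - 1 - (offset (L ^ (n + 1)) m b.1 b.2 : ℕ))) *
              ∏ ν ∈ Finset.univ.erase b.2, (((offset (L ^ (n + 1)) m b.1 ν : ℕ) : ℝ) * (((L ^ (n + 1) : ℕ) : ℝ) - 1 - (offset (L ^ (n + 1)) m b.1 ν : ℕ))) : ℝ) : ℂ) •
            WL2.equiv ℂ (fun _ : Bond d m => c₁) W ψ (blockCoord (L ^ (n + 1)) m b.1, b.2))) with hu'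
    set u : BondL2K ℂ d (towerP L m (n + 1)) c₀ W := (bondL2Cast ℂ h).symm u' with hu
    -- size
    have hsz' : ‖u'‖ ^ 2 ≤ (((((L ^ (n + 1) : ℕ) : ℝ)) ^ 3 * ((((L ^ (n + 1) : ℕ) : ℝ)) ^ 2 / 4) ^ (d - 1)) ^ 2 * (c₀ * (((L ^ (n + 1) : ℕ) : ℝ)) ^ d / c₁)) * ‖ψ‖ ^ 2 := norm_sq_tent_le (L ^ (n + 1)) m c₀ c₁ ψ
    have hnu : ‖u‖ = ‖u'‖ := by
      have := norm_bondL2Cast ℂ h ((bondL2Cast ℂ h).symm u')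
      rw [LinearEquiv.apply_symm_apply] at this
      exact this.symm
    have hsz : ‖u‖ ≤ Real.sqrt (((((L ^ (n + 1) : ℕ) : ℝ)) ^ 3 * ((((L ^ (n + 1) : ℕ) : ℝ)) ^ 2 / 4) ^ (d - 1)) ^ 2 * (c₀ * (((L ^ (n + 1) : ℕ) : ℝ)) ^ d / c₁)) * ‖ψ‖ := by
      rw [hnu]
      have h1 : Real.sqrt (‖u'‖ ^ 2) ≤ Real.sqrt ((((((L ^ (n + 1) : ℕ) : ℝ)) ^ 3 * ((((L ^ (n + 1) : ℕ) : ℝ)) ^ 2 / 4) ^ (d - 1)) ^ 2 * (c₀ * (((L ^ (n + 1) : ℕ) : ℝ)) ^ d / c₁)) * ‖ψ‖ ^ 2) := Real.sqrt_le_sqrt hsz'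
      rwa [Real.sqrt_sq (norm_nonneg _), Real.sqrt_mul hNsq, Real.sqrt_sq (norm_nonneg _)] at h1
    -- the flat pairing at the tower letters
    have hflat : (((((L ^ (n + 1) : ℕ) : ℝ) ^ (d + 1))⁻¹ * ((∑ k ∈ Finset.range (L ^ (n + 1)), (k : ℝ) * ((((L ^ (n + 1) : ℕ) : ℝ)) - 1 - k)) ^ (d - 1) *
          ∑ k ∈ Finset.range (L ^ (n + 1)), ∑ i ∈ Finset.range (L ^ (n + 1) - k), ((k + i : ℕ) : ℝ) ^ 2 * ((((L ^ (n + 1) : ℕ) : ℝ)) - 1 - ((k + i : ℕ) : ℝ)))) -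
        ((((L ^ (n + 1) : ℕ) : ℝ) ^ (d + 1))⁻¹ * ((∑ k ∈ Finset.range (L ^ (n + 1)), (k : ℝ) * ((((L ^ (n + 1) : ℕ) : ℝ)) - 1 - k)) ^ (d - 1) *
          ∑ k ∈ Finset.range (L ^ (n + 1)), ∑ t ∈ Finset.range k, (t : ℝ) ^ 2 * ((((L ^ (n + 1) : ℕ) : ℝ)) - 1 - t)))) * ‖ψ‖ ^ 2 ≤
        RCLike.re ⟪QkW L m n φ (fun _ : Bond d (towerP L m (n + 1)) => (1 : 𝔸ˣ)) hL α₁ hα1₁ hU1₁ hreg₁ (c₀ := c₀) (c₁ := c₁) u, ψ⟫_ℂ := by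
      show _ ≤ RCLike.re ⟪QkW L m n φ (fun _ : Bond d (towerP L m (n + 1)) => (1 : 𝔸ˣ)) hL α₁ hα1₁ hU1₁ hreg₁ (c₀ := c₀) (c₁ := c₁)
        ((bondL2Cast ℂ h).symm u'), ψ⟫_ℂ
      rw [QkW_one_eq_oneStep L m n hL φ α₁ hα1₁ hU1₁ hreg₁ hLk hα1' hU1' hreg' h, LinearMap.comp_apply, LinearEquiv.coe_toLinearMap,
        LinearEquiv.apply_symm_apply]
      exact B9Eq3126KFloorFlat.re_inner_QtorusW_one_tent_ge (L ^ (n + 1)) m hLk hα1' hU1' hreg' φ (c₀ := c₀) (c₁ := c₁) ψ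
    have hpair := pairing_perturb (u := u) hδQ hflat (hQd u) hsz
    -- the energy: forms at `U`, perturbed from the flat forms
    have hE := re_inner_laplaceALatticeK_hessOp_le φ η U τ hRS (RofUk L m n φ η U) (fun s => by
        unfold RofUk B11Eq103H1Complex.RLatticeK; exact norm_projR_le _ _ s) (QkW L m n φ U hL α hα1 hU1 hreg (c₀ := c₀) (c₁ := c₁)) a u
    have hR₁ : ∀ (b : Bond d (towerP L m (n + 1))) (w : W), adTransportW φ (fun _ : Bond d (towerP L m (n + 1)) => (1 : 𝔸ˣ)) b w = w :=
      fun b w => by rw [adTransportW_one]; rfl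
    have hS₁ : ∀ (b : Bond d (towerP L m (n + 1))) (w : W), adTransportW φ (fun _ : Bond d (towerP L m (n + 1)) => (1 : 𝔸ˣ)⁻¹) b w = w :=
      fun b w => by rw [adTransportW_inv_one]; rfl
    have hcurl_d := norm_covCurlL2K_sub_le (c₀ := c₀) ((η : ℂ))⁻¹ hεR hR hR₁ u
    have hdiv_d := norm_covDivL2K_sub_le (c₀ := c₀) ((η : ℂ))⁻¹ hc hεR hR hR₁ hRS hS₁ u
    -- flat forms through the cast
    have hstep : ∀ (x : TSite d (fineP (L ^ (n + 1)) m)) (μ κ : Fin d),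
        ‖(fun b : Bond d (fineP (L ^ (n + 1)) m) => (((((offset (L ^ (n + 1)) m b.1 b.2 : ℕ) : ℝ) ^ 2 * (((L ^ (n + 1) : ℕ) : ℝ) - 1 - (offset (L ^ (n + 1)) m b.1 b.2 : ℕ))) *
              ∏ ν ∈ Finset.univ.erase b.2, (((offset (L ^ (n + 1)) m b.1 ν : ℕ) : ℝ) * (((L ^ (n + 1) : ℕ) : ℝ) - 1 - (offset (L ^ (n + 1)) m b.1 ν : ℕ))) : ℝ) : ℂ) •
            WL2.equiv ℂ (fun _ : Bond d m => c₁) W ψ (blockCoord (L ^ (n + 1)) m b.1, b.2)) (shift μ x, κ) -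
          (fun b : Bond d (fineP (L ^ (n + 1)) m) => (((((offset (L ^ (n + 1)) m b.1 b.2 : ℕ) : ℝ) ^ 2 * (((L ^ (n + 1) : ℕ) : ℝ) - 1 - (offset (L ^ (n + 1)) m b.1 b.2 : ℕ))) *
              ∏ ν ∈ Finset.univ.erase b.2, (((offset (L ^ (n + 1)) m b.1 ν : ℕ) : ℝ) * (((L ^ (n + 1) : ℕ) : ℝ) - 1 - (offset (L ^ (n + 1)) m b.1 ν : ℕ))) : ℝ) : ℂ) •
            WL2.equiv ℂ (fun _ : Bond d m => c₁) W ψ (blockCoord (L ^ (n + 1)) m b.1, b.2)) (x, κ)‖ ≤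
        (6 * (((L ^ (n + 1) : ℕ) : ℝ)) ^ 2 * ((((L ^ (n + 1) : ℕ) : ℝ)) ^ 2 / 4) ^ (d - 1)) *
          ‖WL2.equiv ℂ (fun _ : Bond d m => c₁) W ψ (blockCoord (L ^ (n + 1)) m x, κ)‖ :=
      fun x μ κ => B9Eq3126KFloorFlat.norm_tent_step_le (L ^ (n + 1)) m (WL2.equiv ℂ (fun _ : Bond d m => c₁) W ψ) x μ κ
    have hcurl₁' := B9Eq3126BondLiftEnergy.norm_sq_covCurlL2K_le_of_step (L ^ (n + 1)) m c₀ c₁ ((η : ℂ))⁻¹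
      (adTransportW φ (fun _ : Bond d (fineP (L ^ (n + 1)) m) => (1 : 𝔸ˣ))) (adTransportW_one φ)
      (fun b : Bond d (fineP (L ^ (n + 1)) m) => (((((offset (L ^ (n + 1)) m b.1 b.2 : ℕ) : ℝ) ^ 2 * (((L ^ (n + 1) : ℕ) : ℝ) - 1 - (offset (L ^ (n + 1)) m b.1 b.2 : ℕ))) *
              ∏ ν ∈ Finset.univ.erase b.2, (((offset (L ^ (n + 1)) m b.1 ν : ℕ) : ℝ) * (((L ^ (n + 1) : ℕ) : ℝ) - 1 - (offset (L ^ (n + 1)) m b.1 ν : ℕ))) : ℝ) : ℂ) •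
            WL2.equiv ℂ (fun _ : Bond d m => c₁) W ψ (blockCoord (L ^ (n + 1)) m b.1, b.2)) ψ hstep
    have hdiv₁' := B9Eq3126BondLiftEnergy.norm_sq_covDivL2K_le_of_step (L ^ (n + 1)) m c₀ c₁ ((η : ℂ))⁻¹
      (adTransportW φ (fun _ : Bond d (fineP (L ^ (n + 1)) m) => (1 : 𝔸ˣ)⁻¹)) (adTransportW_inv_one φ)
      (fun b : Bond d (fineP (L ^ (n + 1)) m) => (((((offset (L ^ (n + 1)) m b.1 b.2 : ℕ) : ℝ) ^ 2 * (((L ^ (n + 1) : ℕ) : ℝ) - 1 - (offset (L ^ (n + 1)) m b.1 b.2 : ℕ))) *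
              ∏ ν ∈ Finset.univ.erase b.2, (((offset (L ^ (n + 1)) m b.1 ν : ℕ) : ℝ) * (((L ^ (n + 1) : ℕ) : ℝ) - 1 - (offset (L ^ (n + 1)) m b.1 ν : ℕ))) : ℝ) : ℂ) •
            WL2.equiv ℂ (fun _ : Bond d m => c₁) W ψ (blockCoord (L ^ (n + 1)) m b.1, b.2)) ψ hstep
    have hcurl₁ : ‖covCurlL2K ℂ c₀ ((η : ℂ))⁻¹ (adTransportW φ (fun _ : Bond d (towerP L m (n + 1)) => (1 : 𝔸ˣ))) u‖ ^ 2 ≤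
        ‖((η : ℂ))⁻¹‖ ^ 2 * (6 * (((L ^ (n + 1) : ℕ) : ℝ)) ^ 2 * ((((L ^ (n + 1) : ℕ) : ℝ)) ^ 2 / 4) ^ (d - 1)) ^ 2 * (4 * (d : ℝ)) * (c₀ * (((L ^ (n + 1) : ℕ) : ℝ)) ^ d / c₁) * ‖ψ‖ ^ 2 := by
      have e := norm_covCurlL2K_one_bondL2Cast φ h ((η : ℂ))⁻¹ u
      rw [show bondL2Cast ℂ h u = u' from LinearEquiv.apply_symm_apply _ _] at e
      rw [← e]; exact hcurl₁'
    have hdiv₁ : ‖covDivL2K ℂ c₀ ((η : ℂ))⁻¹ (adTransportW φ (fun _ : Bond d (towerP L m (n + 1)) => (1 : 𝔸ˣ)⁻¹)) u‖ ^ 2 ≤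
        ‖((η : ℂ))⁻¹‖ ^ 2 * (6 * (((L ^ (n + 1) : ℕ) : ℝ)) ^ 2 * ((((L ^ (n + 1) : ℕ) : ℝ)) ^ 2 / 4) ^ (d - 1)) ^ 2 * (d : ℝ) * (c₀ * (((L ^ (n + 1) : ℕ) : ℝ)) ^ d / c₁) * ‖ψ‖ ^ 2 := by
      have e := norm_covDivL2K_inv_one_bondL2Cast φ h ((η : ℂ))⁻¹ u
      rw [show bondL2Cast ℂ h u = u' from LinearEquiv.apply_symm_apply _ _] at e
      rw [← e]; exact hdiv₁'
    have hQ₁ : ‖QkW L m n φ (fun _ : Bond d (towerP L m (n + 1)) => (1 : 𝔸ˣ)) hL α₁ hα1₁ hU1₁ hreg₁ (c₀ := c₀) (c₁ := c₁) u‖ ^ 2 ≤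
        2 * (((((L ^ (n + 1) : ℕ) : ℝ) ^ (d + 1))⁻¹ * ((∑ k ∈ Finset.range (L ^ (n + 1)), (k : ℝ) * ((((L ^ (n + 1) : ℕ) : ℝ)) - 1 - k)) ^ (d - 1) *
          ∑ k ∈ Finset.range (L ^ (n + 1)), ∑ i ∈ Finset.range (L ^ (n + 1) - k), ((k + i : ℕ) : ℝ) ^ 2 * ((((L ^ (n + 1) : ℕ) : ℝ)) - 1 - ((k + i : ℕ) : ℝ)))) ^ 2 +
          ((((L ^ (n + 1) : ℕ) : ℝ) ^ (d + 1))⁻¹ * ((∑ k ∈ Finset.range (L ^ (n + 1)), (k : ℝ) * ((((L ^ (n + 1) : ℕ) : ℝ)) - 1 - k)) ^ (d - 1) *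
          ∑ k ∈ Finset.range (L ^ (n + 1)), ∑ t ∈ Finset.range k, (t : ℝ) ^ 2 * ((((L ^ (n + 1) : ℕ) : ℝ)) - 1 - t))) ^ 2) * ‖ψ‖ ^ 2 := by
      show ‖QkW L m n φ (fun _ : Bond d (towerP L m (n + 1)) => (1 : 𝔸ˣ)) hL α₁ hα1₁ hU1₁ hreg₁ (c₀ := c₀) (c₁ := c₁)
        ((bondL2Cast ℂ h).symm u')‖ ^ 2 ≤ _
      rw [QkW_one_eq_oneStep L m n hL φ α₁ hα1₁ hU1₁ hreg₁ hLk hα1' hU1' hreg' h, LinearMap.comp_apply, LinearEquiv.coe_toLinearMap,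
        LinearEquiv.apply_symm_apply]
      exact B9Eq3126KFloorFlat.norm_sq_QtorusW_one_tent_le (L ^ (n + 1)) m hLk hα1' hU1' hreg' φ (c₀ := c₀) (c₁ := c₁) ψ
    -- combine
    have hcurlU := norm_sq_le_two_mul (x₁ := covCurlL2K ℂ c₀ ((η : ℂ))⁻¹ (adTransportW φ (fun _ : Bond d (towerP L m (n + 1)) => (1 : 𝔸ˣ))) u)
      (xU := covCurlL2K ℂ c₀ ((η : ℂ))⁻¹ (adTransportW φ U) u)
    have hdivU := norm_sq_le_two_mul (x₁ := covDivL2K ℂ c₀ ((η : ℂ))⁻¹ (adTransportW φ (fun _ : Bond d (towerP L m (n + 1)) => (1 : 𝔸ˣ)⁻¹)) u)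
      (xU := covDivL2K ℂ c₀ ((η : ℂ))⁻¹ (adTransportW φ fun b => (U b)⁻¹) u)
    have hQU := norm_sq_le_two_mul (x₁ := QkW L m n φ (fun _ : Bond d (towerP L m (n + 1)) => (1 : 𝔸ˣ)) hL α₁ hα1₁ hU1₁ hreg₁ (c₀ := c₀) (c₁ := c₁) u)
      (xU := QkW L m n φ U hL α hα1 hU1 hreg (c₀ := c₀) (c₁ := c₁) u)
    have hcurv := hcurv u
    have hQd' := hQd u
    have hu2 : ‖u‖ ^ 2 ≤ (((((L ^ (n + 1) : ℕ) : ℝ)) ^ 3 * ((((L ^ (n + 1) : ℕ) : ℝ)) ^ 2 / 4) ^ (d - 1)) ^ 2 * (c₀ * (((L ^ (n + 1) : ℕ) : ℝ)) ^ d / c₁)) * ‖ψ‖ ^ 2 := by rw [hnu]; exact hsz'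
    have hd1 : ‖covCurlL2K ℂ c₀ ((η : ℂ))⁻¹ (adTransportW φ U) u - covCurlL2K ℂ c₀ ((η : ℂ))⁻¹ (adTransportW φ fun _ => 1) u‖ ^ 2 ≤
        (4 * Real.sqrt d * (‖((η : ℂ))⁻¹‖ * εR)) ^ 2 * ((((((L ^ (n + 1) : ℕ) : ℝ)) ^ 3 * ((((L ^ (n + 1) : ℕ) : ℝ)) ^ 2 / 4) ^ (d - 1)) ^ 2 * (c₀ * (((L ^ (n + 1) : ℕ) : ℝ)) ^ d / c₁)) * ‖ψ‖ ^ 2) :=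
      (pow_le_pow_left₀ (norm_nonneg _) hcurl_d 2).trans (by rw [mul_pow]; exact mul_le_mul_of_nonneg_left hu2 (sq_nonneg _))
    have hd2 : ‖covDivL2K ℂ c₀ ((η : ℂ))⁻¹ (adTransportW φ fun b => (U b)⁻¹) u -
        covDivL2K ℂ c₀ ((η : ℂ))⁻¹ (adTransportW φ fun _ => (1 : 𝔸ˣ)⁻¹) u‖ ^ 2 ≤ (‖((η : ℂ))⁻¹‖ * εR * Real.sqrt d) ^ 2 * ((((((L ^ (n + 1) : ℕ) : ℝ)) ^ 3 * ((((L ^ (n + 1) : ℕ) : ℝ)) ^ 2 / 4) ^ (d - 1)) ^ 2 * (c₀ * (((L ^ (n + 1) : ℕ) : ℝ)) ^ d / c₁)) * ‖ψ‖ ^ 2) :=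
      (pow_le_pow_left₀ (norm_nonneg _) hdiv_d 2).trans (by rw [mul_pow]; exact mul_le_mul_of_nonneg_left hu2 (sq_nonneg _))
    have hd3 : ‖QkW L m n φ U hL α hα1 hU1 hreg (c₀ := c₀) (c₁ := c₁) u -
        QkW L m n φ (fun _ : Bond d (towerP L m (n + 1)) => (1 : 𝔸ˣ)) hL α₁ hα1₁ hU1₁ hreg₁ (c₀ := c₀) (c₁ := c₁) u‖ ^ 2 ≤ δQ ^ 2 * ((((((L ^ (n + 1) : ℕ) : ℝ)) ^ 3 * ((((L ^ (n + 1) : ℕ) : ℝ)) ^ 2 / 4) ^ (d - 1)) ^ 2 * (c₀ * (((L ^ (n + 1) : ℕ) : ℝ)) ^ d / c₁)) * ‖ψ‖ ^ 2) :=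
      (pow_le_pow_left₀ (norm_nonneg _) hQd' 2).trans (by rw [mul_pow]; exact mul_le_mul_of_nonneg_left hu2 (sq_nonneg _))
    have hd4 : ‖⟪u, curvOp φ τ η U u⟫_ℂ‖ ≤ Kc * ((((((L ^ (n + 1) : ℕ) : ℝ)) ^ 3 * ((((L ^ (n + 1) : ℕ) : ℝ)) ^ 2 / 4) ^ (d - 1)) ^ 2 * (c₀ * (((L ^ (n + 1) : ℕ) : ℝ)) ^ d / c₁)) * ‖ψ‖ ^ 2) := hcurv.trans (mul_le_mul_of_nonneg_left hu2 hKc)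
    have hQU' := mul_le_mul_of_nonneg_left hQU ha.le
    have hd3' := mul_le_mul_of_nonneg_left hd3 ha.le
    have hQ₁' := mul_le_mul_of_nonneg_left hQ₁ ha.le
    refine ⟨hsz, hpair, hE.trans ?_⟩
    linarith [hcurlU, hdivU, hQU', hd1, hd2, hd3', hd4, hcurl₁, hdiv₁, hQ₁']
  -- `M_U > 0`
  obtain ⟨hB, hAB, -⟩ := B9Eq3126KFloorDiagonal.tent_numbers_bounds (d := d) (L ^ (n + 1)) hL3
  have hβ0 : 0 < ((((L ^ (n + 1) : ℕ) : ℝ) ^ (d + 1))⁻¹ * ((∑ k ∈ Finset.range (L ^ (n + 1)), (k : ℝ) * ((((L ^ (n + 1) : ℕ) : ℝ)) - 1 - k)) ^ (d - 1) *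
          ∑ k ∈ Finset.range (L ^ (n + 1)), ∑ i ∈ Finset.range (L ^ (n + 1) - k), ((k + i : ℕ) : ℝ) ^ 2 * ((((L ^ (n + 1) : ℕ) : ℝ)) - 1 - ((k + i : ℕ) : ℝ)))) -
      ((((L ^ (n + 1) : ℕ) : ℝ) ^ (d + 1))⁻¹ * ((∑ k ∈ Finset.range (L ^ (n + 1)), (k : ℝ) * ((((L ^ (n + 1) : ℕ) : ℝ)) - 1 - k)) ^ (d - 1) *
          ∑ k ∈ Finset.range (L ^ (n + 1)), ∑ t ∈ Finset.range k, (t : ℝ) ^ 2 * ((((L ^ (n + 1) : ℕ) : ℝ)) - 1 - t))) := lt_of_lt_of_le (by positivity) hAB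
  have hA : 0 < ((((L ^ (n + 1) : ℕ) : ℝ) ^ (d + 1))⁻¹ * ((∑ k ∈ Finset.range (L ^ (n + 1)), (k : ℝ) * ((((L ^ (n + 1) : ℕ) : ℝ)) - 1 - k)) ^ (d - 1) *
          ∑ k ∈ Finset.range (L ^ (n + 1)), ∑ i ∈ Finset.range (L ^ (n + 1) - k), ((k + i : ℕ) : ℝ) ^ 2 * ((((L ^ (n + 1) : ℕ) : ℝ)) - 1 - ((k + i : ℕ) : ℝ)))) := lt_of_lt_of_le hβ0 (sub_le_self _ hB)
  have hMU : 0 < 2 * (‖((η : ℂ))⁻¹‖ ^ 2 * (6 * (((L ^ (n + 1) : ℕ) : ℝ)) ^ 2 * ((((L ^ (n + 1) : ℕ) : ℝ)) ^ 2 / 4) ^ (d - 1)) ^ 2 * (5 * (d : ℝ)) * (c₀ * (((L ^ (n + 1) : ℕ) : ℝ)) ^ d / c₁) +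
      a * (2 * (((((L ^ (n + 1) : ℕ) : ℝ) ^ (d + 1))⁻¹ * ((∑ k ∈ Finset.range (L ^ (n + 1)), (k : ℝ) * ((((L ^ (n + 1) : ℕ) : ℝ)) - 1 - k)) ^ (d - 1) *
          ∑ k ∈ Finset.range (L ^ (n + 1)), ∑ i ∈ Finset.range (L ^ (n + 1) - k), ((k + i : ℕ) : ℝ) ^ 2 * ((((L ^ (n + 1) : ℕ) : ℝ)) - 1 - ((k + i : ℕ) : ℝ)))) ^ 2 +
        ((((L ^ (n + 1) : ℕ) : ℝ) ^ (d + 1))⁻¹ * ((∑ k ∈ Finset.range (L ^ (n + 1)), (k : ℝ) * ((((L ^ (n + 1) : ℕ) : ℝ)) - 1 - k)) ^ (d - 1) *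
          ∑ k ∈ Finset.range (L ^ (n + 1)), ∑ t ∈ Finset.range k, (t : ℝ) ^ 2 * ((((L ^ (n + 1) : ℕ) : ℝ)) - 1 - t))) ^ 2))) +
      (2 * (4 * Real.sqrt d * (‖((η : ℂ))⁻¹‖ * εR)) ^ 2 + 2 * (‖((η : ℂ))⁻¹‖ * εR * Real.sqrt d) ^ 2 + Kc + 2 * a * δQ ^ 2) * (((((L ^ (n + 1) : ℕ) : ℝ)) ^ 3 * ((((L ^ (n + 1) : ℕ) : ℝ)) ^ 2 / 4) ^ (d - 1)) ^ 2 * (c₀ * (((L ^ (n + 1) : ℕ) : ℝ)) ^ d / c₁)) := by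
    have h1 : 0 ≤ (2 * (4 * Real.sqrt d * (‖((η : ℂ))⁻¹‖ * εR)) ^ 2 + 2 * (‖((η : ℂ))⁻¹‖ * εR * Real.sqrt d) ^ 2 + Kc + 2 * a * δQ ^ 2) * (((((L ^ (n + 1) : ℕ) : ℝ)) ^ 3 * ((((L ^ (n + 1) : ℕ) : ℝ)) ^ 2 / 4) ^ (d - 1)) ^ 2 * (c₀ * (((L ^ (n + 1) : ℕ) : ℝ)) ^ d / c₁)) := by
      positivity
    nlinarith [hc1, mul_pos ha (pow_pos hA 2), sq_nonneg ((((L ^ (n + 1) : ℕ) : ℝ) ^ (d + 1))⁻¹ * ((∑ k ∈ Finset.range (L ^ (n + 1)), (k : ℝ) * ((((L ^ (n + 1) : ℕ) : ℝ)) - 1 - k)) ^ (d - 1) *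
          ∑ k ∈ Finset.range (L ^ (n + 1)), ∑ t ∈ Finset.range k, (t : ℝ) ^ 2 * ((((L ^ (n + 1) : ℕ) : ℝ)) - 1 - t)))]
  refine ⟨fun y => ?_, fun b => ?_⟩
  · exact B9Eq3126GreenLettersVariational.norm_KinvK_le_of_test (𝕜 := ℂ) hpos hadj_adjoint (adjoint_injective_of_surjective _ hQ) hsym hMU hβU
      (fun ψ => (key ψ).2.1) (fun ψ => (key ψ).2.2) y
  · exact B9Eq3126GreenLettersVariational.norm_H1K_le_of_test (𝕜 := ℂ) hpos hadj_adjoint (adjoint_injective_of_surjective _ hQ) hγ hcoer hsym hMU hβU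
      (fun ψ => (key ψ).2.1) (fun ψ => (key ψ).2.2) b

end Windowed

end Literature.MathematicalPhysics.QuantumFieldTheory.Balaban1983to89.B9Eq3126KFloorWindowedTower

end
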